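import Summits.CriticalPhenomena.PercolationContinuityZ3.Theorems.Transplant.FKDoubleFanOneSided
import Summits.CriticalPhenomena.PercolationContinuityZ3.Theorems.Transplant.FKDoubleFanCrossApexRoof
import Summits.CriticalPhenomena.PercolationContinuityZ3.Theorems.Transplant.FKThreeApexUCondRimStep
import HarnessLib

/-!
# Double fans, one-sided far pairs: FIBRE LINEARITY of `fanPhi` in all three legs (the ray-reduction step of LEMMA′)

Helper file (`--supports stmt-CriticalPhenomena-4575`), FK sub-lane `prim-bschramm-fk-3` (gen 31); builds on p205010 (kernel theorem, internal audit signed; external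
expert review pending).  Pure real algebra, no sorries; standard axioms.  Memo `bschramm/prim-bschramm-fk-3/FAR-CROSS-VI.md` §10(j).

`fanPhi q F u s` (`…DoubleFanOneSided`) is homogeneous-linear in the apex fibre coordinates of each leg: `u` in the apex-`b` split `vecB q W y X Z u₀`
(free `X, Z, u₀`), `s` in the apex-`a` split `swapAB (vecB q W z X Y s₀)`, and the fan vector `F` in the apex-`c` split of the fan triple,
`swapAC (swapAB (vecB q W x X Z f₀))` (free `X, Z, f₀`; fixed `x̂_F, v̂_F`).  Hence the floor/roof ray decomposition of `…CrossApexInKE` applies to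
all three legs (U_c on `F`, U_b on `u`, U_a on `s`).
[folklore]
-/

noncomputable section

namespace Summit.CriticalPhenomena.PercolationContinuityZ3.Theorems

namespace FK

namespace ThreeApex

/-- **Linearity in the apex-`b` coordinates of the prefix** `u = vecB q W y X Z u₀`. [folklore] -/
theorem fanPhi_linB (q W y X Z u0 : ℝ) (F s : V5) :
    fanPhi q F (vecB q W y X Z u0) s = X * fanPhi q F (vecB q W y 1 0 0) s + Z * fanPhi q F (vecB q W y 0 1 0) s
      + u0 * fanPhi q F (vecB q W y 0 0 1) s := by
  simp only [fanPhi, vecB, hx, hy, hz, V5.total]; ring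

/-- **Linearity in the apex-`a` coordinates of the suffix** `s = swapAB (vecB q W z X Y s₀)`. [folklore] -/
theorem fanPhi_linA (q W z X Y s0 : ℝ) (F u : V5) :
    fanPhi q F u (swapAB (vecB q W z X Y s0)) = X * fanPhi q F u (swapAB (vecB q W z 1 0 0)) + Y * fanPhi q F u (swapAB (vecB q W z 0 1 0))
      + s0 * fanPhi q F u (swapAB (vecB q W z 0 0 1)) := by
  simp only [fanPhi, vecB, swapAB, hx, hy, hz, V5.total]; ring

/-- **Linearity in the apex-`c` coordinates of the FAN VECTOR** `F = swapAC (swapAB (vecB q W x X Z f₀))` (fixed `x̂_F = x`, `v̂_F`). [folklore] -/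
theorem fanPhi_linC (q W x X Z f0 : ℝ) (u s : V5) :
    fanPhi q (swapAC (swapAB (vecB q W x X Z f0))) u s = X * fanPhi q (swapAC (swapAB (vecB q W x 1 0 0))) u s
      + Z * fanPhi q (swapAC (swapAB (vecB q W x 0 1 0))) u s + f0 * fanPhi q (swapAC (swapAB (vecB q W x 0 0 1))) u s := by
  simp only [fanPhi, vecB, swapAB, swapAC, hx, hy, hz, V5.total]; ring

/-- Affinity along `f₀`: convex combinations of the floor (`f₀ = a`) and roof (`f₀ = b`) points of the fan leg pass through `fanPhi`. [folklore] -/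
theorem fanPhi_f0_affine (q W x X Z a b c : ℝ) (u s : V5) :
    fanPhi q (swapAC (swapAB (vecB q W x X Z (c * a + (1 - c) * b)))) u s =
      c * fanPhi q (swapAC (swapAB (vecB q W x X Z a))) u s + (1 - c) * fanPhi q (swapAC (swapAB (vecB q W x X Z b))) u s := by
  rw [fanPhi_linC q W x X Z (c * a + (1 - c) * b), fanPhi_linC q W x X Z a, fanPhi_linC q W x X Z b]; ring

end ThreeApex

end FK

end Summit.CriticalPhenomena.PercolationContinuityZ3.Theorems
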